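import Mathlib

/-!
# Crux `FeketeSOS.SublinearShadow` (stmt-ValiantsHypothesis-14990), line `Sketch`,
# stub `stub_windowOfSupportShadow`: an exact representation on given supports is a window model

Bridge (reshape 2) of the line.  If `F = Σ_i Σ_{k<m} a_{ik} h_{ik}²` in `K[X]` with
`supp h_{ik} ⊆ S_i`, put `M := 2m² + 1`, `e_k := k·M + k²` (`k < m`) and `v := 2(m·M + m²)`, so
`2 e_k ≤ v` and `v + 1 = 4m³ + 2m² + 2m + 1 ≤ 4(m+1)³`.  In `K[X][Π]` take the digit expansions
`Y_i := Σ_k h_{ik} Π^{e_k}` and the weights `γ_i := Σ_k a_{ik} Π^{v − 2e_k} ∈ K[Π]`.  Then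
`γ_i Y_i² = Σ_{k,l,l'} a_{ik} h_{il} h_{il'} Π^{(v − 2e_k) + e_l + e_{l'}}`, and a term sits in
`Π`-degree `v` iff `e_l + e_{l'} = 2e_k`; comparing quotient and remainder modulo `M`
(`l² + l'² < M`, `2k² < M`) gives `l + l' = 2k` and `l² + l'² = 2k²`, whence
`(l − l')² = 2(l² + l'²) − (l + l')² = 0` and `l = l' = k` (the exponents are 3-AP-free).  So the
`Π^v`-digit of `Σ_i γ_i Y_i²` is `Σ_i Σ_k a_{ik} h_{ik}² = F`; degrees are `≤ v` termwise, and the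
`Π^n`-digit of `Y_i` is `Σ_{k : e_k = n} h_{ik}`, supported on `S_i`.

Layout: window lemmas for an abstract exponent family `e : Fin m → ℕ` with `2e_k ≤ v` and no
nontrivial solution of `e_l + e_{l'} = 2e_k`; the arithmetic of the concrete exponents; the
registered statement.
-/

namespace Summit.ValiantsHypothesis.ValiantsHypothesis.Theorems.SublinearShadowSketch

open Polynomial Finset
open scoped BigOperators

-- `Summit.ValiantsHypothesis.ValiantsHypothesis.…` is the tree's mandated single-conjunct layout (Sub = Summit).
set_option linter.dupNamespace false

/-- Coefficients of a product of three monomials `C x Π^p · (C y Π^q · C z Π^r)`. [folklore] -/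
theorem wss_coeff_three_monomials {R : Type*} [CommSemiring R] (x y z : R) (p q r n : ℕ) :
    (C x * X ^ p * (C y * X ^ q * (C z * X ^ r))).coeff n
      = if n = p + (q + r) then x * (y * z) else 0 := by
  have H : C x * X ^ p * (C y * X ^ q * (C z * X ^ r)) = C (x * (y * z)) * X ^ (p + (q + r)) := by
    simp only [map_mul, pow_add]
    ring
  rw [H, coeff_C_mul_X_pow]

/-- **The `Π^v`-layer of one class.**  For exponents `e` with `2e_k ≤ v` and no nontrivial
solution of `e_l + e_{l'} = 2e_k`, the `Π^v`-coefficient of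
`(Σ_k a_k Π^{v − 2e_k}) · (Σ_k h_k Π^{e_k})²` is `Σ_k a_k h_k²`: only the diagonal terms
`k = l = l'` land in degree `v`. [folklore] -/
theorem wss_coeff_layer {R : Type*} [CommRing R] {m : ℕ} (e : Fin m → ℕ) (v : ℕ)
    (he : ∀ k, 2 * e k ≤ v) (hap : ∀ k l l', e l + e l' = 2 * e k → l = k ∧ l' = k)
    (a : Fin m → R) (h : Fin m → R[X]) :
    ((∑ k, C (a k) * X ^ (v - 2 * e k)).map (C : R →+* R[X]) *
        (∑ k, C (h k) * X ^ (e k)) ^ 2).coeff v = ∑ k, C (a k) * h k ^ 2 := by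
  simp only [Polynomial.map_sum, Polynomial.map_mul, Polynomial.map_pow, Polynomial.map_C,
    Polynomial.map_X]
  rw [pow_two, Finset.sum_mul_sum, Finset.sum_mul_sum]
  simp only [Finset.mul_sum, finsetSum_coeff, wss_coeff_three_monomials]
  refine Finset.sum_congr rfl fun k _ => ?_
  have key : ∀ l l', v = v - 2 * e k + (e l + e l') ↔ l = k ∧ l' = k := fun l l' =>
    ⟨fun H => hap k l l' (by have := he k; omega),
     fun H => by rw [H.1, H.2]; have := he k; omega⟩
  simp_rw [key]
  rw [Fintype.sum_eq_single k fun l hl => by simp [hl],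
    Fintype.sum_eq_single k fun l' hl' => by simp [hl'], if_pos ⟨rfl, rfl⟩, pow_two]

/-- **Digits of a digit expansion.**  The `Π^n`-coefficient of `Σ_k h_k Π^{e_k}` is
`Σ_{k : e_k = n} h_k`, so it is supported wherever all the `h_k` are. [folklore] -/
theorem wss_digit_support {R : Type*} [Semiring R] {m : ℕ} (e : Fin m → ℕ) (h : Fin m → R[X])
    (S : Finset ℕ) (hh : ∀ k, (h k).support ⊆ S) (n : ℕ) :
    ((∑ k, C (h k) * X ^ (e k)).coeff n).support ⊆ S := by
  intro j hj
  by_contra hjS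
  rw [mem_support_iff] at hj
  apply hj
  simp only [finsetSum_coeff, coeff_C_mul_X_pow]
  refine Finset.sum_eq_zero fun k _ => ?_
  split_ifs
  · exact notMem_support_iff.mp fun hm => hjS (hh k hm)
  · exact coeff_zero j

/-- **Generic window model from a progression-free exponent family.**  Given
`F = Σ_i Σ_k a_{ik} h_{ik}²` with `supp h_{ik} ⊆ S_i`, exponents `e_k` with `2e_k ≤ v` and no
nontrivial solution of `e_l + e_{l'} = 2e_k`, the weights `γ_i := Σ_k a_{ik} Π^{v − 2e_k}` and
digit expansions `Y_i := Σ_k h_{ik} Π^{e_k}` have `Π`-degree `≤ v`, digits on `S_i`, and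
`Π^v`-layer `Σ_i Σ_k a_{ik} h_{ik}²`. [folklore] -/
theorem wss_window (K : Type) [Field K] (s m : ℕ) (S : Fin s → Finset ℕ)
    (a : Fin s → Fin m → K) (h : Fin s → Fin m → K[X]) (hh : ∀ i k, (h i k).support ⊆ S i)
    (e : Fin m → ℕ) (v : ℕ) (he : ∀ k, 2 * e k ≤ v)
    (hap : ∀ k l l', e l + e l' = 2 * e k → l = k ∧ l' = k) :
    ∃ (γ : Fin s → K[X]) (Y : Fin s → K[X][X]),
      (∀ i, (γ i).natDegree ≤ v) ∧ (∀ i, (Y i).natDegree ≤ v) ∧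
      (∀ i n, ((Y i).coeff n).support ⊆ S i) ∧
      (∑ i, (γ i).map (C : K →+* K[X]) * Y i ^ 2).coeff v = ∑ i, ∑ k, C (a i k) * h i k ^ 2 := by
  refine ⟨fun i => ∑ k, C (a i k) * X ^ (v - 2 * e k), fun i => ∑ k, C (h i k) * X ^ (e k),
    fun i => ?_, fun i => ?_, fun i n => wss_digit_support e (h i) (S i) (hh i) n, ?_⟩
  · exact natDegree_sum_le_of_forall_le _ _ fun k _ =>
      (natDegree_C_mul_X_pow_le _ _).trans (Nat.sub_le _ _)
  · exact natDegree_sum_le_of_forall_le _ _ fun k _ =>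
      (natDegree_C_mul_X_pow_le _ _).trans (by have := he k; omega)
  · rw [finsetSum_coeff]
    exact Finset.sum_congr rfl fun i _ => wss_coeff_layer e v he hap (a i) (h i)

/-- **Uniqueness of base-`M` digits.**  If `l² + l'² < M`, `2k² < M` and
`(l·M + l²) + (l'·M + l'²) = 2(k·M + k²)`, then `l + l' = 2k` and `l² + l'² = 2k²`, hence
`(l − l')² = 0` and `l = l' = k`. [folklore] -/
theorem wss_apfree_aux {M k l l' : ℕ} (h1 : l * l + l' * l' < M) (h2 : 2 * (k * k) < M)
    (H : l * M + l * l + (l' * M + l' * l') = 2 * (k * M + k * k)) : l = k ∧ l' = k := by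
  have hM : 0 < M := by omega
  have H' : l * l + l' * l' + (l + l') * M = 2 * (k * k) + 2 * k * M :=
    calc l * l + l' * l' + (l + l') * M = l * M + l * l + (l' * M + l' * l') := by ring
      _ = 2 * (k * M + k * k) := H
      _ = 2 * (k * k) + 2 * k * M := by ring
  have hq : (l * l + l' * l' + (l + l') * M) / M = (2 * (k * k) + 2 * k * M) / M := by rw [H']
  have hr : (l * l + l' * l' + (l + l') * M) % M = (2 * (k * k) + 2 * k * M) % M := by rw [H']
  rw [Nat.add_mul_div_right _ _ hM, Nat.add_mul_div_right _ _ hM, Nat.div_eq_of_lt h1,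
    Nat.div_eq_of_lt h2] at hq
  rw [Nat.add_mul_mod_self_right, Nat.add_mul_mod_self_right, Nat.mod_eq_of_lt h1,
    Nat.mod_eq_of_lt h2] at hr
  have e1 : ((l : ℤ) + l') = 2 * k := by exact_mod_cast (show l + l' = 2 * k by omega)
  have e2 : ((l : ℤ) * l + l' * l') = 2 * (k * k) := by exact_mod_cast hr
  have e3 : ((l : ℤ) - l') ^ 2 = 0 := by
    linear_combination 2 * e2 - ((l : ℤ) + l' + 2 * k) * e1
  have hll' : (l : ℤ) = l' := sub_eq_zero.mp (pow_eq_zero_iff two_ne_zero |>.mp e3)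
  omega

/-- **The concrete exponents are 3-AP-free.**  With `M = 2m² + 1` and `e_k = k·M + k²` for
`k < m`: `e_l + e_{l'} = 2e_k → l = k ∧ l' = k`. [folklore] -/
theorem wss_apfree (m : ℕ) (k l l' : Fin m)
    (H : (l : ℕ) * (2 * (m * m) + 1) + l * l + ((l' : ℕ) * (2 * (m * m) + 1) + l' * l')
      = 2 * ((k : ℕ) * (2 * (m * m) + 1) + k * k)) : l = k ∧ l' = k := by
  have hl := Nat.mul_self_lt_mul_self l.isLt
  have hl' := Nat.mul_self_lt_mul_self l'.isLt
  have hk := Nat.mul_self_lt_mul_self k.isLt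
  obtain ⟨h₁, h₂⟩ := wss_apfree_aux (M := 2 * (m * m) + 1) (by omega) (by omega) H
  exact ⟨Fin.ext h₁, Fin.ext h₂⟩

/-- `2e_k ≤ v := 2(m·M + m²)` for the concrete exponents `e_k = k·M + k²`, `k < m`. [folklore] -/
theorem wss_two_e_le (m : ℕ) (k : Fin m) :
    2 * ((k : ℕ) * (2 * (m * m) + 1) + k * k) ≤ 2 * (m * (2 * (m * m) + 1) + m * m) := by
  have h1 : (k : ℕ) * (2 * (m * m) + 1) ≤ m * (2 * (m * m) + 1) :=
    Nat.mul_le_mul_right _ k.isLt.le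
  have h2 : (k : ℕ) * k ≤ m * m := Nat.mul_self_le_mul_self k.isLt.le
  omega

/-- **Bridge: an exact representation on the supports is a window model of polynomial order.**  If
`F = Σ_i Σ_{k<m} a_{ik} h_{ik}²` with `supp h_{ik} ⊆ S_i`, then with the 3-AP-free exponents `e_k = k·M + k²`
(`M = 2m² + 1`) the digit expansions `Y_i = Σ_k h_{ik} Π^{e_k}` and weights `γ_i = Σ_k a_{ik} Π^{v − 2e_k}`,
`v = 2(m·M + m²)`, have `Π`-degree `≤ v ≤ 4(m+1)³ − 1`, `X`-digits on `S_i`, and `Π^v`-layer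
`Σ_i Σ_k a_{ik} h_{ik}² = F` (a cross term `a_{ik} h_{il} h_{il'}` sits in degree `v − 2e_k + e_l + e_{l'} = v` iff
`e_l + e_{l'} = 2e_k` iff `l = l' = k`). [folklore] -/
theorem stub_windowOfSupportShadow (K : Type) [Field K] (s m : ℕ) (S : Fin s → Finset ℕ)
    (a : Fin s → Fin m → K) (h : Fin s → Fin m → Polynomial K) (F : Polynomial K)
    (hh : ∀ i k, (h i k).support ⊆ S i)
    (hrep : (∑ i, ∑ k, Polynomial.C (a i k) * h i k ^ 2) = F) :
    ∃ (v : ℕ) (γ : Fin s → Polynomial K) (Y : Fin s → Polynomial (Polynomial K)),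
      v + 1 ≤ 4 * (m + 1) ^ 3 ∧ (∀ i, (γ i).natDegree ≤ v) ∧ (∀ i, (Y i).natDegree ≤ v) ∧
      (∀ i n, ((Y i).coeff n).support ⊆ S i) ∧
      (∑ i, (γ i).map (Polynomial.C : K →+* Polynomial K) * Y i ^ 2).coeff v = F := by
  obtain ⟨γ, Y, hγ, hY, hS, hF⟩ := wss_window K s m S a h hh
    (fun k : Fin m => (k : ℕ) * (2 * (m * m) + 1) + k * k) (2 * (m * (2 * (m * m) + 1) + m * m))
    (fun k => wss_two_e_le m k) (fun k l l' H => wss_apfree m k l l' H)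
  exact ⟨_, γ, Y, Nat.le.intro (k := 10 * (m * m) + 10 * m + 3) (by ring), hγ, hY, hS,
    hF.trans hrep⟩

end Summit.ValiantsHypothesis.ValiantsHypothesis.Theorems.SublinearShadowSketch
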